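import Summits.SmoothPoincare4.SmoothPoincare4.Theorems.SoloInformedPuncturedEmbedding
import Literature.Topology.FourManifolds.RLinkComponentsHomotopyBallSlice
import HarnessLib
import HarnessLib.Audit.Tags

/-!
# R-link components are slice, given the punctured Poincaré embedding conjecture

Solo informed SmoothPoincare4, session 19 — the componentwise "(SL_k)" consequence of the
boundary-free embedding conjecture `PuncturedPoincareSphereEmbedding` (EMB°,
`SoloInformedPuncturedEmbedding.lean`), recorded in `sharpest-statement.md` item (21d):

  EMB°  ⟹  (every homotopy-ball-slice knot is slice)  ⟹  every component of every R-link is slice.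

An *R-link* is a framed `n`-component link in `S³` whose framed surgery is `#ⁿ (S¹ × S²)`.  By
Gompf–Scharlemann–Thompson 2010, Prop. 2.3 (Hillman) its components are slice in a homotopy
4-ball — the tree's named fact `Literature.Topology.FourManifolds.GompfScharlemannThompson2010_prop23`
(statement only; taken as a hypothesis, nothing asserted).  Composing with
`isSmoothlySlice_of_isHomotopyBallSlice_of_puncturedEmbedding` gives the theorem below.  For
`n = 1` the conclusion is known unconditionally (Property R, Gabai 1987: the only knot with an
`S¹ × S²` surgery is the unknot); for `n ≥ 2` it is open in general and is implied by SPC4.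

Sources: R. E. Gompf, M. Scharlemann, A. Thompson, *Fibered knots and potential counterexamples to
the Property 2R and Slice-Ribbon Conjectures*, Geom. Topol. 14 (2010) 2305–2347, Prop. 2.3
[GompfScharlemannThompson2010]; M. Freedman, R. Gompf, S. Morrison, K. Walker, *Man and machine
thinking about the smooth 4-dimensional Poincaré conjecture*, Quantum Topol. 1 (2010), §1
[FGMW2010].  No new axioms, no `sorry`.
-/

noncomputable section

open scoped Manifold ContDiff Topology
open Literature.Topology.FourManifolds

namespace Summit.SmoothPoincare4.SmoothPoincare4.Theorems

/-- **EMB° ⟹ components of R-links are slice.**  Assuming the punctured Poincaré embedding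
conjecture and the named fact GST 2010 Prop. 2.3 (components of an R-link are slice in a homotopy
4-ball), every component of a framed link `L ⊂ S³` whose surgery is `#ⁿ (S¹ × S²)` is smoothly
slice. [cite: GompfScharlemannThompson2010, Prop. 2.3] -/
theorem rLinkComponent_isSmoothlySlice_of_puncturedEmbedding
    (hE : PuncturedPoincareSphereEmbedding) (hGST : GompfScharlemannThompson2010_prop23)
    (n : ℕ) (L : FramedLink (Fin n)) (Y : Type) [TopologicalSpace Y] [T2Space Y]
    [SecondCountableTopology Y] [ChartedSpace (EuclideanSpace ℝ (Fin 3)) Y]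
    [IsManifold (𝓡 3) ((⊤ : ℕ∞) : WithTop ℕ∞) Y] [CompactSpace Y] [ConnectedSpace Y]
    (hY : IsSphereTwoProdCircleSum n Y) (hL : L.IsSurgery (𝓡 3) Y) (i : Fin n) :
    (L.component i).IsSmoothlySlice :=
  isSmoothlySlice_of_isHomotopyBallSlice_of_puncturedEmbedding hE _ (hGST n L Y hY hL i)

/-- **SPC4 ⟹ components of R-links are slice** (through EMB°), modulo the named fact GST 2010
Prop. 2.3. [cite: GompfScharlemannThompson2010, Prop. 2.3] -/
theorem rLinkComponent_isSmoothlySlice_of_smoothPoincare4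
    (h : SmoothPoincare4) (hGST : GompfScharlemannThompson2010_prop23)
    (n : ℕ) (L : FramedLink (Fin n)) (Y : Type) [TopologicalSpace Y] [T2Space Y]
    [SecondCountableTopology Y] [ChartedSpace (EuclideanSpace ℝ (Fin 3)) Y]
    [IsManifold (𝓡 3) ((⊤ : ℕ∞) : WithTop ℕ∞) Y] [CompactSpace Y] [ConnectedSpace Y]
    (hY : IsSphereTwoProdCircleSum n Y) (hL : L.IsSurgery (𝓡 3) Y) (i : Fin n) :
    (L.component i).IsSmoothlySlice :=
  rLinkComponent_isSmoothlySlice_of_puncturedEmbedding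
    (puncturedPoincareSphereEmbedding_of_smoothPoincare4 h) hGST n L Y hY hL i

/-- Contrapositive: an R-link with a non-slice component refutes EMB° (given GST 2010 Prop. 2.3),
hence refutes the first conjunct of the embedding route to SPC4.
[cite: GompfScharlemannThompson2010, Prop. 2.3] -/
theorem not_puncturedPoincareSphereEmbedding_of_rLinkComponent_not_isSmoothlySlice
    (hGST : GompfScharlemannThompson2010_prop23)
    (h : ∃ (n : ℕ) (L : FramedLink (Fin n)) (Y : Type) (_ : TopologicalSpace Y) (_ : T2Space Y)
      (_ : SecondCountableTopology Y) (_ : ChartedSpace (EuclideanSpace ℝ (Fin 3)) Y)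
      (_ : IsManifold (𝓡 3) ((⊤ : ℕ∞) : WithTop ℕ∞) Y) (_ : CompactSpace Y) (_ : ConnectedSpace Y),
      IsSphereTwoProdCircleSum n Y ∧ L.IsSurgery (𝓡 3) Y ∧ ∃ i : Fin n,
        ¬ (L.component i).IsSmoothlySlice) :
    ¬ PuncturedPoincareSphereEmbedding := by
  rintro hE
  obtain ⟨n, L, Y, _, _, _, _, _, _, _, hY, hL, i, hi⟩ := h
  exact hi (rLinkComponent_isSmoothlySlice_of_puncturedEmbedding hE hGST n L Y hY hL i)

end Summit.SmoothPoincare4.SmoothPoincare4.Theorems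

end
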